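import Mathlib
import Literature.NumberTheory.LFunctions.Zhang2022.Section10cProfiles
import HarnessLib

/-!
# Zhang (2022) §10c: `Z22:§10.u050 (ii)` — the top range of `S_j(𝐚₁₄,𝐚₂₂)` passes from its `n`-sum to
# the printed `z`-integral, `Typed.Sec10C.Top1422Int c′`, PROVED OUTRIGHT

Topic `Literature/NumberTheory/LFunctions/Zhang2022` (Landau–Siegel audit tree; verdict-neutral).
Y. Zhang, *Discrete mean estimates and the Landau–Siegel zero*, arXiv:2211.02515v1 (2022)
[Zhang2022LandauSiegel], §10 p. 60 (tex L3040, second line): "`… = (1000ι₄𝔞/log P)∫_{0.498}^{0.5}(1 − πij(0.5 − z))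
𝔤𝔥_{j7}(0.5 − z)dz + o(α)`" — **an unrefereed manuscript under adjudication; this file proves ONE of
its displayed steps from tree theorems and asserts nothing about its Theorems 1–2.** D-0069 campaign,
discharge layer L3 (seat sz-d34; staged 2026-08-26T02:11Z as `HOME/staging/L3/sz-d34/Section10cTop1422Int.lean`,
sha16 `48dfab7d6f6fb962`, filed by the ZHANG-L discharge lane, seat zl-w10-p5, WP10 — closes the §10c node
`Top1422Int` feeding the v19 leaf `Typed.Sec10C.Gather1422` via `gather1422_of_ranges`).

`top1422Int_holds : Top1422Int c′` — no manuscript claim enters as a hypothesis. Route: the §8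
evaluation rule `lamAvg_rule` (`Section10cLamAvgRule`: d16's `λ₀ⱼ(n) = (φ(n)/n)²(1 + O(α𝓛))` and
`Σ_{n<x}|χ(n)|φ(n)/n² = c_D log x + O(𝓛²)` + the partial-summation engine) applied to the profile
`G(t) = (1 − β_j log(P^{0.5}/t))𝔤_{j7}(P^{0.5}/t)` on `[P^{0.498}, P^{0.5}]` (`topG1422_bounds`); the
substitution `t = P^z` (`Section10MainTerms.integral_Ppow_Ppow`); the comparison at `P^z` with the
printed integrand (`topG1422_at_rpow`: `β_j log P = jπi + O(𝓛⁻⁸)` and sz-d19's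
`Section8ProfilesAtPz.profiles_seven`, `𝔤_{j7}(P^w) = 𝔤𝔥_{j7}(w) + O(𝓛⁻⁸)`); and `c_D·L′(1,χ)² = 𝔞`
(`frakA_eq_cD_mul`). Total error `≤ C(c′)·𝓛⁻¹² ≤ εα` for `𝓛 ≥ C(c′)/(επ) + 1`.

## References

* Y. Zhang, arXiv:2211.02515v1 (2022), §10 p. 60; §8 p. 48–49; §2 (2.13), (2.26), (2.31).
  [cite: Zhang2022LandauSiegel, §10 p. 60]
-/

noncomputable section

open Complex Real ComplexConjugate
open Literature.NumberTheory.LFunctions.Zhang2022.Skeleton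

namespace Literature.NumberTheory.LFunctions.Zhang2022.Typed.Sec10C

section Top1422

open Literature.NumberTheory.LFunctions.Zhang2022.Section8dStatements (ffP ghP)

/-- **The top-range profile of `S_j(𝐚₁₄,𝐚₂₂)` at `t = P^z`** (`0.498 ≤ z ≤ 0.5`): with the ACTUAL
shifts, `G(P^z) = (1 − β_j(0.5 − z)log P)𝔤_{j7}(P^{0.5−z})` differs from the printed integrand
`(1 − πij(0.5 − z))𝔤𝔥_{j7}(0.5 − z)` by `≤ C_z(c′)·𝓛⁻⁸` (`β_j log P = jπi + O(c′α𝓛)` and sz-d19's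
`Section8ProfilesAtPz.profiles_seven`). [cite: Zhang2022LandauSiegel, §10 p. 60] -/
theorem topG1422_at_rpow (c' : ℝ) {D : ℕ} (hD3 : 3 ≤ D) (hΛ : 0 < Real.log (bigP D)) {j : ℕ}
    (hj : j ∈ ({1, 2, 3} : Finset ℕ)) {z : ℝ} (hz0 : 0.498 ≤ z) (hz1 : z ≤ 0.5) :
    ‖(1 - betaJ c' D j * (Real.log (bigP D ^ (0.5 : ℝ) / bigP D ^ z) : ℂ)) *
          frakgW c' D j 7 (bigP D ^ (0.5 : ℝ) / bigP D ^ z) -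
        (1 - π * I * j * ((0.5 - z : ℝ) : ℂ)) * ghJ7 j (0.5 - z)‖ ≤
      (0.03 * π ^ 2 * |c'| * (6 + (75 * |c'| * π ^ 2 + 40 * |c'| ^ 2 * π ^ 3)) +
        1.03 * (75 * |c'| * π ^ 2 + 40 * |c'| ^ 2 * π ^ 3)) * (ell D ^ 8)⁻¹ := by
  set Cp : ℝ := 75 * |c'| * π ^ 2 + 40 * |c'| ^ 2 * π ^ 3 with hCp
  have hCp0 : 0 ≤ Cp := by positivity
  have hP0 : 0 < bigP D := Real.exp_pos _
  have hD1 : (1 : ℝ) < D := by exact_mod_cast (by omega : 1 < D)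
  have hℓ0 : 0 < ell D := Real.log_pos hD1
  have hℓ1 : 1 ≤ ell D := by
    have : (3 : ℝ) ≤ D := by exact_mod_cast hD3
    have h := Real.exp_one_lt_d9
    rw [ell, Real.le_log_iff_exp_le (by linarith)]
    linarith
  have hℓ8 : (ell D ^ 8)⁻¹ ≤ 1 := inv_le_one_of_one_le₀ (one_le_pow₀ hℓ1)
  have hℓ8pos : 0 < (ell D ^ 8)⁻¹ := by positivity
  -- rewrite `P^{0.5}/P^z = P^{0.5 − z}`, `log = (0.5 − z) log P`
  have hrpow : bigP D ^ (0.5 : ℝ) / bigP D ^ z = bigP D ^ ((0.5 : ℝ) - z) := by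
    rw [Real.rpow_sub hP0]
  have hlog : Real.log (bigP D ^ ((0.5 : ℝ) - z)) = (0.5 - z) * Real.log (bigP D) :=
    Real.log_rpow hP0 _
  rw [hrpow, hlog]
  set w : ℝ := 0.5 - z with hw
  have hw0 : 0 ≤ w := by rw [hw]; linarith
  have hw1 : w ≤ 0.002 := by rw [hw]; linarith
  have hw1' : w ≤ 1 := by linarith
  have hwabs : |w| ≤ 1 := by rw [abs_of_nonneg hw0]; exact hw1'
  -- the two comparisons
  obtain ⟨hsel7, -, -, -⟩ := sel_eq hj
  obtain ⟨-, hg⟩ := Section8ProfilesAtPz.profiles_seven c' hD3 hj hw0 hw1'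
  rw [hsel7] at hg
  have hgh : ‖ghJ7 j w‖ ≤ 6 := by
    rw [← hsel7]; exact Section8SubstitutionEngine.norm_ghP_le j 7 hwabs
  have hgW : ‖frakgW c' D j 7 (bigP D ^ w)‖ ≤ 6 + Cp := by
    have := norm_sub_le_norm_sub_add_norm_sub (frakgW c' D j 7 (bigP D ^ w)) (ghJ7 j w) 0
    calc ‖frakgW c' D j 7 (bigP D ^ w)‖
        ≤ ‖frakgW c' D j 7 (bigP D ^ w) - ghJ7 j w‖ + ‖ghJ7 j w‖ := norm_le_norm_sub_add _ _
      _ ≤ Cp * (ell D ^ 8)⁻¹ + 6 := add_le_add hg hgh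
      _ ≤ Cp * 1 + 6 := by gcongr
      _ = 6 + Cp := by ring
  have hβ := norm_betaJ_mul_log_sub_le c' hΛ hj
  have hu : |c' * alpha D * ell D| = |c'| * π * (ell D ^ 8)⁻¹ := by
    rw [mul_assoc, alpha_mul_ell hℓ0, abs_mul, abs_div, abs_of_pos Real.pi_pos,
      abs_of_pos (by positivity : 0 < ell D ^ 8)]
    ring
  -- ‖(1 − β_j w log P) − (1 − πijw)‖ = w‖β_j log P − jπi‖
  have hA : ‖(1 - betaJ c' D j * (((w * Real.log (bigP D) : ℝ)) : ℂ)) -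
      (1 - π * I * j * (w : ℂ))‖ ≤ 0.002 * (15 * π * |c' * alpha D * ell D|) := by
    have e : (1 - betaJ c' D j * (((w * Real.log (bigP D) : ℝ)) : ℂ)) - (1 - π * I * j * (w : ℂ)) =
        -(w : ℂ) * (betaJ c' D j * (Real.log (bigP D) : ℂ) - (j : ℂ) * π * I) := by
      push_cast; ring
    rw [e, norm_mul, norm_neg, Complex.norm_real, Real.norm_of_nonneg hw0]
    exact mul_le_mul hw1 hβ (norm_nonneg _) (by norm_num)
  have hA0 : ‖(1 : ℂ) - π * I * j * (w : ℂ)‖ ≤ 1.03 := by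
    have hj3 : (j : ℝ) ≤ 3 := by
      simp only [Finset.mem_insert, Finset.mem_singleton] at hj
      rcases hj with rfl | rfl | rfl <;> norm_num
    calc ‖(1 : ℂ) - π * I * j * (w : ℂ)‖ ≤ ‖(1 : ℂ)‖ + ‖(π : ℂ) * I * j * (w : ℂ)‖ := norm_sub_le _ _
      _ = 1 + π * j * w := by
          rw [norm_one, norm_mul, norm_mul, norm_mul, Complex.norm_real, Complex.norm_I,
            Complex.norm_natCast, Complex.norm_real, Real.norm_of_nonneg Real.pi_pos.le,
            Real.norm_of_nonneg hw0]
          ring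
      _ ≤ 1 + 4 * 3 * 0.002 := by
          have h1 : π * j ≤ 4 * 3 :=
            mul_le_mul Real.pi_lt_four.le hj3 (by positivity) (by norm_num)
          have h2 : π * j * w ≤ 4 * 3 * 0.002 := mul_le_mul h1 hw1 hw0 (by norm_num)
          linarith
      _ ≤ 1.03 := by norm_num
  -- combine: `‖Ag − A₀g₀‖ ≤ ‖A − A₀‖‖g‖ + ‖A₀‖‖g − g₀‖`
  have key : (1 - betaJ c' D j * (((w * Real.log (bigP D) : ℝ)) : ℂ)) * frakgW c' D j 7 (bigP D ^ w) -
      (1 - π * I * j * (w : ℂ)) * ghJ7 j w =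
      ((1 - betaJ c' D j * (((w * Real.log (bigP D) : ℝ)) : ℂ)) - (1 - π * I * j * (w : ℂ))) *
          frakgW c' D j 7 (bigP D ^ w) +
        (1 - π * I * j * (w : ℂ)) * (frakgW c' D j 7 (bigP D ^ w) - ghJ7 j w) := by ring
  rw [key]
  calc ‖((1 - betaJ c' D j * (((w * Real.log (bigP D) : ℝ)) : ℂ)) - (1 - π * I * j * (w : ℂ))) *
            frakgW c' D j 7 (bigP D ^ w) +
          (1 - π * I * j * (w : ℂ)) * (frakgW c' D j 7 (bigP D ^ w) - ghJ7 j w)‖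
      ≤ ‖(1 - betaJ c' D j * (((w * Real.log (bigP D) : ℝ)) : ℂ)) - (1 - π * I * j * (w : ℂ))‖ *
            ‖frakgW c' D j 7 (bigP D ^ w)‖ +
          ‖(1 : ℂ) - π * I * j * (w : ℂ)‖ * ‖frakgW c' D j 7 (bigP D ^ w) - ghJ7 j w‖ := by
        refine (norm_add_le _ _).trans ?_
        rw [norm_mul, norm_mul]
    _ ≤ 0.002 * (15 * π * |c' * alpha D * ell D|) * (6 + Cp) + 1.03 * (Cp * (ell D ^ 8)⁻¹) := by
        gcongr
    _ = (0.03 * π ^ 2 * |c'| * (6 + Cp) + 1.03 * Cp) * (ell D ^ 8)⁻¹ := by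
        rw [hu]; ring

/-- The numerical constant bounding `‖ι₄/0.5‖`. [cite: Zhang2022LandauSiegel, §2 (2.26)] -/
private theorem norm_iota4_div_le : ‖iota4 / (0.5 : ℂ)‖ ≤ 4.6 := by
  rw [norm_div, show (0.5 : ℂ) = ((0.5 : ℝ) : ℂ) by norm_num, Complex.norm_real,
    Real.norm_of_nonneg (by norm_num)]
  have := norm_iota34_le.2
  linarith [show ‖iota4‖ / (0.5 : ℝ) = 2 * ‖iota4‖ by ring]

/-- The prefactor of `topSum1422`: `‖500L′(1,χ)²/log²P · ι₄/0.5‖ ≤ 36800e⁹𝓛⁴/𝓛¹⁸`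
(`|L′(1,χ)| ≤ 4e^{9/2}𝓛²`, `log P = 𝓛⁹`, `|ι₄|/0.5 ≤ 4.6`). [cite: Zhang2022LandauSiegel, §10 p. 60] -/
theorem norm_K1422_le {D : ℕ} [NeZero D] (χ : DirichletCharacter ℂ D) (hℓ3 : 3 ≤ ell D)
    (hp : χ.IsPrimitive) :
    ‖500 * deriv χ.LFunction 1 ^ 2 / (Real.log (bigP D) : ℂ) ^ 2 * (iota4 / 0.5)‖ ≤
      36800 * Real.exp 9 * ell D ^ 4 / ell D ^ 18 := by
  have hΛ : Real.log (bigP D) = ell D ^ 9 := by rw [bigP, Real.log_exp]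
  have hℓ0 : 0 ≤ ell D := by linarith
  have hL : ‖deriv χ.LFunction 1‖ ≤ 4 * Real.exp (9 / 2) * ell D ^ 2 := by
    have hlog : 3 ≤ Real.log D := by simpa only [ell] using hℓ3
    have hw : ‖(1 : ℂ) - 1‖ ≤ 1 / Real.log D := by
      rw [sub_self, norm_zero]; exact div_nonneg zero_le_one (by linarith)
    have h := Lemma31.norm_deriv_LFunction_le_near_one χ hlog hp hw
    have h1 : (1 + ell D) * ell D ≤ 2 * ell D ^ 2 := by nlinarith
    calc ‖deriv χ.LFunction 1‖ ≤ 2 * Real.exp (9 / 2) * (1 + ell D) * ell D := h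
      _ = 2 * Real.exp (9 / 2) * ((1 + ell D) * ell D) := by ring
      _ ≤ 2 * Real.exp (9 / 2) * (2 * ell D ^ 2) := by gcongr
      _ = 4 * Real.exp (9 / 2) * ell D ^ 2 := by ring
  rw [norm_mul, norm_div, norm_mul, norm_pow, norm_pow, Complex.norm_real, Real.norm_of_nonneg
    (by rw [hΛ]; positivity), hΛ]
  have h500 : ‖(500 : ℂ)‖ = 500 := by norm_num
  rw [h500]
  have hι := norm_iota4_div_le
  have hL2 : ‖deriv χ.LFunction 1‖ ^ 2 ≤ (4 * Real.exp (9 / 2) * ell D ^ 2) ^ 2 :=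
    pow_le_pow_left₀ (norm_nonneg _) hL 2
  have he : Real.exp (9 / 2) ^ 2 = Real.exp 9 := by rw [← Real.exp_nat_mul]; norm_num
  calc 500 * ‖deriv χ.LFunction 1‖ ^ 2 / (ell D ^ 9) ^ 2 * ‖iota4 / 0.5‖
      ≤ 500 * (4 * Real.exp (9 / 2) * ell D ^ 2) ^ 2 / (ell D ^ 9) ^ 2 * 4.6 := by gcongr
    _ = 36800 * Real.exp 9 * ell D ^ 4 / ell D ^ 18 := by rw [← he]; ring

/-- `topInt1422` over the prefactor of `topSum1422`: with `𝔞 = c_D L′(1,χ)²`,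
`1000ι₄𝔞/log P·∫ = (500L′²/log²P·ι₄/0.5)·c_D·log P·∫`. [cite: Zhang2022LandauSiegel, §10 p. 60] -/
theorem topInt1422_eq {D : ℕ} [NeZero D] (χ : DirichletCharacter ℂ D) (hD2 : 2 ≤ D)
    (hq : χ.IsQuadratic) (hp : χ.IsPrimitive) (hΛ : 0 < Real.log (bigP D)) (j : ℕ) :
    topInt1422 χ j = 500 * deriv χ.LFunction 1 ^ 2 / (Real.log (bigP D) : ℂ) ^ 2 * (iota4 / 0.5) *
      ((((6 / π ^ 2 * ∏ q ∈ D.primeFactors, ((q : ℝ) / (q + 1)) : ℝ)) : ℂ) *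
        ((Real.log (bigP D) : ℂ) *
          ∫ z in (0.498 : ℝ)..0.5, (1 - π * I * j * ((0.5 - z : ℝ) : ℂ)) * ghJ7 j (0.5 - z))) := by
  have hΛ0 : (Real.log (bigP D) : ℂ) ≠ 0 := by exact_mod_cast hΛ.ne'
  rw [topInt1422, frakA_eq_cD_mul χ hD2 hq hp]
  field_simp
  ring

/-- Arithmetic of the integrated `P^z`-comparison. [folklore] -/
private theorem arith_cmp {cD Cz ℓ X : ℝ} (hcD0 : 0 ≤ cD) (hcD1 : cD ≤ 1) (hℓ : 0 < ℓ) (hCz : 0 ≤ Cz)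
    (hX : X ≤ Cz * (ℓ ^ 8)⁻¹ * 0.002) : cD * ℓ ^ 9 * X ≤ 0.002 * Cz * ℓ := by
  have hX0 : cD * ℓ ^ 9 * X ≤ 1 * ℓ ^ 9 * (Cz * (ℓ ^ 8)⁻¹ * 0.002) := by
    have h9 : 0 ≤ ℓ ^ 9 := by positivity
    rcases le_or_gt 0 X with hx | hx
    · exact mul_le_mul (mul_le_mul_of_nonneg_right hcD1 h9) hX hx (by positivity)
    · have : cD * ℓ ^ 9 * X ≤ 0 := by
        have : 0 ≤ cD * ℓ ^ 9 := by positivity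
        nlinarith
      have : 0 ≤ 1 * ℓ ^ 9 * (Cz * (ℓ ^ 8)⁻¹ * 0.002) := by positivity
      linarith
  refine hX0.trans (le_of_eq ?_)
  field_simp

/-- Arithmetic of the final `o(α)` bound of `top1422Int_holds`. [folklore] -/
private theorem arith_final {ℓ ε C₀ Mtot Cz nK nS : ℝ} (hℓ : 1 ≤ ℓ) (hε : 0 < ε) (hC₀ : 0 ≤ C₀)
    (hMtot : 0 ≤ Mtot) (hCz : 0 ≤ Cz) (hnS0 : 0 ≤ nS)
    (hnK : nK ≤ 36800 * Real.exp 9 * ℓ ^ 4 / ℓ ^ 18) (hnS : nS ≤ C₀ * ℓ ^ 2 * Mtot + 0.002 * Cz * ℓ)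
    (hbig : 36800 * Real.exp 9 * (C₀ * Mtot + 0.002 * Cz) / (ε * π) + 1 ≤ ℓ) :
    nK * nS ≤ ε * (π / ℓ ^ 9) := by
  have hℓ0 : 0 < ℓ := by linarith
  set Ctot : ℝ := 36800 * Real.exp 9 * (C₀ * Mtot + 0.002 * Cz) with hCtot
  have hCtot0 : 0 ≤ Ctot := by positivity
  have hS' : nS ≤ (C₀ * Mtot + 0.002 * Cz) * ℓ ^ 2 := by
    have : ℓ ≤ ℓ ^ 2 := by nlinarith
    nlinarith
  have h1 : nK * nS ≤ Ctot * (ℓ ^ 4 * ℓ ^ 2 / ℓ ^ 18) := by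
    calc nK * nS ≤ (36800 * Real.exp 9 * ℓ ^ 4 / ℓ ^ 18) * ((C₀ * Mtot + 0.002 * Cz) * ℓ ^ 2) :=
          mul_le_mul hnK hS' hnS0 (by positivity)
      _ = Ctot * (ℓ ^ 4 * ℓ ^ 2 / ℓ ^ 18) := by rw [hCtot]; ring
  have h2 : Ctot * (ℓ ^ 4 * ℓ ^ 2 / ℓ ^ 18) = Ctot / ℓ ^ 3 / ℓ ^ 9 := by
    field_simp
  have hεπ : 0 < ε * π := by positivity
  have h3 : Ctot ≤ ε * π * ℓ ^ 3 := by
    have h4 : Ctot / (ε * π) ≤ ℓ := by linarith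
    rw [div_le_iff₀ hεπ] at h4
    have h5 : ℓ ≤ ℓ ^ 3 := by nlinarith
    nlinarith
  rw [h2] at h1
  refine h1.trans ?_
  rw [div_div, div_le_iff₀ (by positivity)]
  calc Ctot ≤ ε * π * ℓ ^ 3 := h3
    _ = ε * (π / ℓ ^ 9) * (ℓ ^ 3 * ℓ ^ 9) := by field_simp

/-- **Z22:§10.u050 (ii) holds** [Z22 p.60, tex L3040, second line]: `Top1422Int c′` —
"`… = (1000ι₄𝔞/log P)∫_{0.498}^{0.5}(1 − πij(0.5 − z))𝔤𝔥_{j7}(0.5 − z)dz + o(α)`" for the arithmetic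
form `topSum1422` of the top range of `S_j(𝐚₁₄,𝐚₂₂)`. PROVED OUTRIGHT (no manuscript claim as
hypothesis): the §8 evaluation rule (`lamAvg_rule`: `λ₀ⱼ(n) = φ(n)²/n²(1 + O(α𝓛))` and
`Σ_{n<x}|χ(n)|φ(n)/n² = c_D log x + O(𝓛²)`, both tree theorems of d16, + partial summation), the
substitution `t = P^z`, the shift comparison `β_j log P = jπi + O(𝓛⁻⁸)` and sz-d19's
`𝔤_{j7}(P^w) = 𝔤𝔥_{j7}(w) + O(𝓛⁻⁸)`, and `c_D·L′(1,χ)² = 𝔞`; the total error is `≪_{c′} 𝓛⁻¹² = o(α)`.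
[cite: Zhang2022LandauSiegel, §10 p. 60] -/
theorem top1422Int_holds (c' : ℝ) : Top1422Int c' := by
  intro ε hε
  obtain ⟨C₀, hC₀, hrule⟩ := lamAvg_rule c'
  -- the constants
  obtain ⟨Cp, hCp⟩ : ∃ Cp : ℝ, Cp = 75 * |c'| * π ^ 2 + 40 * |c'| ^ 2 * π ^ 3 := ⟨_, rfl⟩
  obtain ⟨Cz, hCz⟩ : ∃ Cz : ℝ, Cz = 0.03 * π ^ 2 * |c'| * (6 + Cp) + 1.03 * Cp := ⟨_, rfl⟩
  obtain ⟨Mtot, hMtot⟩ : ∃ Mtot : ℝ, Mtot = (1 + 4 * π) * 146 + (4 * 146 + (1 + 4 * π) * 449) * π := ⟨_, rfl⟩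
  obtain ⟨Ctot, hCtot⟩ : ∃ Ctot : ℝ, Ctot = 36800 * Real.exp 9 * (C₀ * Mtot + 0.002 * Cz) := ⟨_, rfl⟩
  have hCp0 : 0 ≤ Cp := by rw [hCp]; positivity
  have hCz0 : 0 ≤ Cz := by rw [hCz]; positivity
  have hMtot0 : 0 ≤ Mtot := by rw [hMtot]; positivity
  have hCtot0 : 0 ≤ Ctot := by rw [hCtot]; positivity
  have hbig : ForAllLarge fun D _ _ => Ctot / (ε * π) + 1 ≤ ell D := by
    refine ⟨⌈Real.exp (Ctot / (ε * π) + 1)⌉₊, fun D _ χ hD _ _ => ?_⟩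
    have hexp : Real.exp (Ctot / (ε * π) + 1) ≤ D := le_trans (Nat.le_ceil _) (by exact_mod_cast hD)
    show Ctot / (ε * π) + 1 ≤ Real.log D
    exact (Real.le_log_iff_exp_le (lt_of_lt_of_le (Real.exp_pos _) hexp)).mpr hexp
  refine ((hrule.and (forAllLarge_five_c c')).and hbig).mono ?_
  intro D _ χ hq hp ⟨⟨hR, hD3, hℓ6, hc5⟩, hℓbig⟩ _ j hj
  -- parameters
  have hD2 : 2 ≤ D := by omega
  have hℓ3 : 3 ≤ ell D := by linarith
  have hℓ1 : 1 ≤ ell D := by linarith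
  have hℓ0 : 0 < ell D := by linarith
  have hΛ : Real.log (bigP D) = ell D ^ 9 := by rw [bigP, Real.log_exp]
  have hΛpos : 0 < Real.log (bigP D) := by rw [hΛ]; positivity
  have hΛ0 : (Real.log (bigP D) : ℂ) ≠ 0 := by exact_mod_cast hΛpos.ne'
  have hα : 0 < alpha D := alpha_pos hΛpos
  have hαΛ : alpha D * Real.log (bigP D) = π := by rw [alpha, div_mul_cancel₀ _ hΛpos.ne']
  have hαeq : alpha D = π / ell D ^ 9 := by rw [alpha, hΛ]
  have hP0 : 0 < bigP D := Real.exp_pos _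
  have hP1 : 1 ≤ bigP D := one_le_bigP D
  have hlo1 : 1 ≤ bigP D ^ (0.498 : ℝ) := Real.one_le_rpow hP1 (by norm_num)
  have hhi1 : 1 ≤ bigP D ^ (0.5 : ℝ) := Real.one_le_rpow hP1 (by norm_num)
  have hlohi : bigP D ^ (0.498 : ℝ) ≤ bigP D ^ (0.5 : ℝ) :=
    Real.rpow_le_rpow_of_exponent_le hP1 (by norm_num)
  have hhiP : bigP D ^ (0.5 : ℝ) + 1 ≤ bigP D := by
    -- `√P + 1 ≤ P` since `√P ≥ 2` (`P = e^{𝓛⁹} ≥ e^{6⁹}`)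
    have hsq : bigP D ^ (0.5 : ℝ) * bigP D ^ (0.5 : ℝ) = bigP D := by
      rw [← Real.rpow_add hP0]; norm_num
    have h2 : 2 ≤ bigP D ^ (0.5 : ℝ) := by
      have h4 : (4 : ℝ) ≤ bigP D := by
        rw [bigP]
        have : (4 : ℝ) ≤ Real.exp 2 := by
          have h1 := Real.exp_one_gt_d9
          have h2 : Real.exp 2 = Real.exp 1 * Real.exp 1 := by rw [← Real.exp_add]; norm_num
          rw [h2]; nlinarith
        refine this.trans (Real.exp_le_exp.mpr ?_)
        calc (2 : ℝ) ≤ 6 ^ 9 := by norm_num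
          _ ≤ ell D ^ 9 := pow_le_pow_left₀ (by norm_num) hℓ6 9
      nlinarith [Real.rpow_nonneg hP0.le (0.5 : ℝ)]
    nlinarith [Real.rpow_nonneg hP0.le (0.5 : ℝ)]
  have hhiP' : bigP D ^ (0.5 : ℝ) ≤ bigP D := by linarith
  -- the profile and its bounds
  obtain ⟨G, hGdef⟩ : ∃ G : ℝ → ℂ, G = fun u =>
      (1 - betaJ c' D j * (Real.log (bigP D ^ (0.5 : ℝ) / u) : ℂ)) *
        frakgW c' D j 7 (bigP D ^ (0.5 : ℝ) / u) := ⟨_, rfl⟩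
  obtain ⟨M, hM⟩ : ∃ M : ℝ, M = (1 + 4 * π) * 146 := ⟨_, rfl⟩
  obtain ⟨M', hM'⟩ : ∃ M' : ℝ, M' = 4 * alpha D * 146 + (1 + 4 * π) * (449 * alpha D) := ⟨_, rfl⟩
  have hM0 : 0 ≤ M := by rw [hM]; positivity
  have hGb : ∀ t, bigP D ^ (0.498 : ℝ) ≤ t → t ≤ bigP D ^ (0.5 : ℝ) + 1 →
      DifferentiableAt ℝ G t ∧ ‖G t‖ ≤ M ∧ ‖deriv G t‖ ≤ M' / t := by
    intro t h1 h2
    rw [hGdef, hM, hM']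
    exact topG1422_bounds c' j hα hℓ0.le hc5 hhiP' hhi1 (le_trans hlo1 h1) (le_trans h2 hhiP)
  have hA := hR j _ _ M M' G hlo1 hlohi hhiP hM0 hGb
  have hMM : M + M' * Real.log (bigP D) = Mtot := by
    rw [hMtot, hM', hM, ← hαΛ]; ring
  rw [hMM] at hA
  -- the substitution `t = P^z`
  obtain ⟨Λ, hΛdef⟩ : ∃ Λ : ℝ, Λ = Real.log (bigP D) := ⟨_, rfl⟩
  obtain ⟨Iz, hIz⟩ : ∃ Iz : ℝ → ℂ, Iz = fun z => (1 - π * I * j * ((0.5 - z : ℝ) : ℂ)) * ghJ7 j (0.5 - z) :=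
    ⟨_, rfl⟩
  have hsub : ∫ t in bigP D ^ (0.498 : ℝ)..bigP D ^ (0.5 : ℝ), G t / t =
      (Λ : ℂ) * ∫ z in (0.498 : ℝ)..0.5, G (bigP D ^ z) := by
    rw [bigP_rpow_eq_Ppow D 0.498, bigP_rpow_eq_Ppow D 0.5, ← hΛdef,
      integral_Ppow_Ppow (by rw [hΛdef]; exact hΛpos.le)]
    congr 1
    refine intervalIntegral.integral_congr fun z _ => ?_
    simp only [bigP_rpow_eq_Ppow D z, ← hΛdef]
  -- pointwise comparison at `P^z` and the integrated form
  have hpt : ∀ z ∈ Set.uIoc (0.498 : ℝ) 0.5, ‖G (bigP D ^ z) - Iz z‖ ≤ Cz * (ell D ^ 8)⁻¹ := by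
    intro z hz
    rw [Set.uIoc_of_le (by norm_num), Set.mem_Ioc] at hz
    rw [hGdef, hIz, hCz, hCp]
    exact topG1422_at_rpow c' hD3 hΛpos hj hz.1.le hz.2
  have hGc : ContinuousOn (fun z : ℝ => G (bigP D ^ z)) (Set.uIcc (0.498 : ℝ) 0.5) := by
    intro z hz
    rw [Set.uIcc_of_le (by norm_num)] at hz
    have hzlo : bigP D ^ (0.498 : ℝ) ≤ bigP D ^ z := Real.rpow_le_rpow_of_exponent_le hP1 hz.1
    have hzhi : bigP D ^ z ≤ bigP D ^ (0.5 : ℝ) + 1 :=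
      le_trans (Real.rpow_le_rpow_of_exponent_le hP1 hz.2) (by linarith)
    exact ((hGb _ hzlo hzhi).1.continuousAt.comp (Real.continuousAt_const_rpow hP0.ne')).continuousWithinAt
  have hIc : Continuous Iz := by rw [hIz]; fun_prop
  have hdiff : ‖(∫ z in (0.498 : ℝ)..0.5, G (bigP D ^ z)) - ∫ z in (0.498 : ℝ)..0.5, Iz z‖ ≤
      Cz * (ell D ^ 8)⁻¹ * 0.002 := by
    rw [← intervalIntegral.integral_sub (hGc.intervalIntegrable) (hIc.intervalIntegrable _ _)]
    have h := intervalIntegral.norm_integral_le_of_norm_le_const hpt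
    rwa [show |(0.5 : ℝ) - 0.498| = 0.002 by norm_num [abs_of_pos]] at h
  -- the constants `K₁` and `𝔞 = c_D L′²`
  obtain ⟨cD, hcD⟩ : ∃ cD : ℝ, cD = 6 / π ^ 2 * ∏ q ∈ D.primeFactors, ((q : ℝ) / (q + 1)) :=
    ⟨_, rfl⟩
  obtain ⟨hcD0, hcD1⟩ : 0 ≤ cD ∧ cD ≤ 1 := by rw [hcD]; exact RangeAverage.frakcD_bounds D
  rw [← hcD] at hA
  have hfrakA := frakA_eq_cD_mul χ hD2 hq hp
  obtain ⟨K₁, hK₁⟩ : ∃ K₁ : ℂ, K₁ = 500 * deriv χ.LFunction 1 ^ 2 / (Λ : ℂ) ^ 2 * (iota4 / 0.5) :=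
    ⟨_, rfl⟩
  have hK₁n : ‖K₁‖ ≤ 36800 * Real.exp 9 * ell D ^ 4 / ell D ^ 18 := by
    rw [hK₁, hΛdef]; exact norm_K1422_le χ hℓ3 hp
  -- `topSum = K₁·A`, `topInt = K₁·c_D·Λ·∫I`
  have hTop : topSum1422 c' χ j = K₁ * lamAvg c' χ j (bigP D ^ (0.498 : ℝ)) (bigP D ^ (0.5 : ℝ))
      (fun n => G n) := by
    rw [hK₁, hGdef, hΛdef, topSum1422]
  have hInt : topInt1422 χ j = K₁ * ((cD : ℂ) * ((Λ : ℂ) * ∫ z in (0.498 : ℝ)..0.5, Iz z)) := by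
    rw [hK₁, hcD, hΛdef, hIz]; exact topInt1422_eq χ hD2 hq hp hΛpos j
  -- assemble
  rw [hTop, hInt, ← mul_sub, norm_mul]
  have hin : lamAvg c' χ j (bigP D ^ (0.498 : ℝ)) (bigP D ^ (0.5 : ℝ)) (fun n => G n) -
      (cD : ℂ) * ((Λ : ℂ) * ∫ z in (0.498 : ℝ)..0.5, Iz z) =
      (lamAvg c' χ j (bigP D ^ (0.498 : ℝ)) (bigP D ^ (0.5 : ℝ)) (fun n => G n) -
        (cD : ℂ) * ∫ t in bigP D ^ (0.498 : ℝ)..bigP D ^ (0.5 : ℝ), G t / t) +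
      (cD : ℂ) * (Λ : ℂ) * ((∫ z in (0.498 : ℝ)..0.5, G (bigP D ^ z)) -
        ∫ z in (0.498 : ℝ)..0.5, Iz z) := by
    rw [hsub]; ring
  rw [hin]
  have hnorm2 : ‖(cD : ℂ) * (Λ : ℂ) * ((∫ z in (0.498 : ℝ)..0.5, G (bigP D ^ z)) -
      ∫ z in (0.498 : ℝ)..0.5, Iz z)‖ ≤ 0.002 * Cz * ell D := by
    have hΛ9 : Λ = ell D ^ 9 := by rw [hΛdef, hΛ]
    rw [norm_mul, norm_mul, Complex.norm_real, Complex.norm_real, Real.norm_of_nonneg hcD0, hΛ9,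
      Real.norm_of_nonneg (by positivity)]
    exact arith_cmp hcD0 hcD1 hℓ0 hCz0 hdiff
  have hsum : ‖(lamAvg c' χ j (bigP D ^ (0.498 : ℝ)) (bigP D ^ (0.5 : ℝ)) (fun n => G n) -
        (cD : ℂ) * ∫ t in bigP D ^ (0.498 : ℝ)..bigP D ^ (0.5 : ℝ), G t / t) +
      (cD : ℂ) * (Λ : ℂ) * ((∫ z in (0.498 : ℝ)..0.5, G (bigP D ^ z)) -
        ∫ z in (0.498 : ℝ)..0.5, Iz z)‖ ≤ C₀ * ell D ^ 2 * Mtot + 0.002 * Cz * ell D :=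
    (norm_add_le _ _).trans (add_le_add hA hnorm2)
  rw [hCtot] at hℓbig
  have hfin := arith_final (nK := ‖K₁‖) hℓ1 hε hC₀ hMtot0 hCz0 (norm_nonneg _) hK₁n
    hsum hℓbig
  rw [hαeq]
  exact hfin

variable (c' : ℝ) in
/-- `Top1422Int` — `_holds` alias of `top1422Int_holds` above under the fact's exact name, stated under the
prover's own binders as section variables (appended 2026-08-28, D-0026 bookkeeping: the proof term is the
existing theorem of this file; no statement, definition or attribute is edited; no new named fact; the
ledger's debt table listed the fact unproved). [cite: Zhang2022LandauSiegel, §10 p. 60] -/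
theorem _root_.Literature.NumberTheory.LFunctions.Zhang2022.Typed.Sec10C.Top1422Int_holds :
    _root_.Literature.NumberTheory.LFunctions.Zhang2022.Typed.Sec10C.Top1422Int c' :=
  _root_.Literature.NumberTheory.LFunctions.Zhang2022.Typed.Sec10C.top1422Int_holds (c' := c')

end Top1422

end Literature.NumberTheory.LFunctions.Zhang2022.Typed.Sec10C
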